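import Mathlib.InformationTheory.KullbackLeibler.KLFun
import Mathlib.Analysis.Convex.Jensen
import Mathlib.Analysis.SpecialFunctions.Log.Base
import Literature.InformationTheory.Entropy.MapEntropy
import Literature.InformationTheory.Entropy.MapEntropySubadditivity
import Literature.InformationTheory.Entropy.MapEntropyPi
import HarnessLib

/-!
# Large subsets of a product have few biased coordinates (Razborov 1990; Rothvoss 2017, Lemma 10)

Topic `Literature/InformationTheory/Entropy` (the `mapEntropy` API: Shannon entropy, in bits, of
the image of the uniform distribution on a finite set). The **pseudo-random behaviour of large
sets**, in the form of T. Rothvoss, *The matching polytope has exponential extension complexity*,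
J. ACM 64 (2017) 41, **Lemma 10** (a generalisation of the entropy-counting step of Razborov's
rectangle corruption lemma): for every `ε > 0` and `q ∈ ℕ` there is `δ = δ(ε, q) > 0` such that for
finite sets `X₁, …, X_m` with `1 ≤ |Xᵢ| ≤ q` and every `Y ⊆ X₁ × ⋯ × X_m` with
`|Y| ≥ 2^{-δ m} |X|`, all but at most `ε m` indices `i` are *`ε`-unbiased*:
`(1/(1+ε)) / |Xᵢ| ≤ Pr_{y ∼ Y}[yᵢ = j] ≤ (1+ε) / |Xᵢ|` for every `j ∈ Xᵢ`.

Proof as printed (entropy counting): `log₂ |Y| = H(y) ≤ ∑ᵢ H(yᵢ)` (sub-additivity) and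
`H(yᵢ) ≤ log₂ |Xᵢ|`, with a uniform gap `H(yᵢ) ≤ log₂ |Xᵢ| - c` at every biased index. The paper
obtains `c = c(ε, q) > 0` "for compactness reasons"; here it is made explicit through the identity
`log₂ N - H(p) = (1 / (N ln 2)) ∑_j klFun(N p_j)` (`klFun x = x log x + 1 - x`, Mathlib's
`InformationTheory.klFun`) and the convexity of `klFun` with its unique zero at `1`:
`klFun x ≥ min (klFun (1+ε)) (klFun (1+ε)⁻¹) > 0` off the interval `((1+ε)⁻¹, 1+ε)`.

* `mul_log_div_eq_klFun` — `p log(u/p) = u - p - u · klFun(p/u)`;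
* `mapEntropy_le_logb_sub_klFun` — `H(f(U_S)) ≤ log₂ |T| - klFun(|T| p_{j₀}) / (|T| ln 2)` for any
  `T ⊇ f(S)` and `j₀ ∈ T` (in particular `H ≤ log₂ |T|`);
* `klFun_inv_le_of_le`, `klFun_le_of_le`, `klFun_gap_pos` — the gap constant;
* `mapEntropy_pi_le` — `m`-fold sub-additivity `H((fᵢ)ᵢ) ≤ ∑ᵢ H(fᵢ)` (from the pair case
  `mapEntropy_prod_le` of `MapEntropySubadditivity.lean`);
* `few_biased_coordinates` — Lemma 10, for a dependent product `(i : κ) → X i` of finite types.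

## References

* T. Rothvoss, *The matching polytope has exponential extension complexity*, J. ACM 64(6) (2017)
  41:1–41:19, Lemma 10 [Rothvoss2017].
* A. Razborov, *On the distributional complexity of disjointness*, Theoret. Comput. Sci. 106
  (1992) 385–390 (ICALP 1990), the entropy step of the main lemma. [folklore]
-/

namespace Literature.InformationTheory.Entropy

open Finset _root_.InformationTheory

universe u v

variable {ι β : Type*} [DecidableEq β]

/-! ### Entropy deficit against the uniform distribution, through `klFun` -/

/-- `p log(u/p) = u - p - u · klFun(p/u)` for `p ≥ 0`, `u > 0` (with `0 · log _ = 0` and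
`klFun 0 = 1` the case `p = 0` reads `0 = u - 0 - u`). [folklore] -/
theorem mul_log_div_eq_klFun {p u : ℝ} (hp : 0 ≤ p) (hu : 0 < u) :
    p * Real.log (u / p) = u - p - u * klFun (p / u) := by
  rcases hp.eq_or_lt with rfl | hp
  · simp [klFun_zero]
  · rw [klFun_apply]
    have : Real.log (u / p) = -Real.log (p / u) := by
      rw [← Real.log_inv, inv_div]
    rw [this]
    field_simp
    ring

/-- **Entropy deficit.** For `S ≠ ∅`, `f(S) ⊆ T` and any `j₀ ∈ T`, writing `p_j = |f⁻¹(j) ∩ S|/|S|`: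
`H(f(U_S)) ≤ log₂ |T| - klFun(|T| · p_{j₀}) / (|T| · ln 2)`. (In fact
`log₂ |T| - H = ∑_{j ∈ T} klFun(|T| p_j) / (|T| ln 2)`; one non-negative term is kept.)
[folklore] -/
theorem mapEntropy_le_logb_sub_klFun {S : Finset ι} (hS : S.Nonempty) (f : ι → β)
    {T : Finset β} (hT : ∀ v ∈ S, f v ∈ T) {j₀ : β} (hj₀ : j₀ ∈ T) :
    mapEntropy S f ≤ Real.logb 2 (T.card : ℝ) -
      klFun (T.card * (((fiber S f j₀).card : ℝ) / S.card)) / (T.card * Real.log 2) := by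
  have hSpos : (0 : ℝ) < S.card := by exact_mod_cast hS.card_pos
  have hTpos : (0 : ℝ) < T.card := by exact_mod_cast card_pos.2 ⟨j₀, hj₀⟩
  have hlog2 : (0 : ℝ) < Real.log 2 := Real.log_pos one_lt_two
  set N : ℝ := (T.card : ℝ) with hN
  set p : β → ℝ := fun j => ((fiber S f j).card : ℝ) / S.card with hp
  have hp0 : ∀ j, 0 ≤ p j := fun j => by positivity
  have himg : S.image f ⊆ T := image_subset_iff.2 hT
  -- total mass one on `T`
  have hsum : ∑ j ∈ T, p j = 1 := by
    have h1 : ∑ j ∈ S.image f, p j = 1 := by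
      simp only [hp]
      rw [← sum_div, sum_card_fiber_image, div_self hSpos.ne']
    rw [← h1]
    symm
    refine sum_subset himg fun j _ hj => ?_
    have : fiber S f j = ∅ := by
      refine eq_empty_of_forall_notMem fun w hw => hj ?_
      rw [mem_fiber] at hw
      exact mem_image.2 ⟨w, hw.1, hw.2⟩
    simp [hp, this]
  -- the entropy as a sum over `T`
  have hH : mapEntropy S f = (∑ j ∈ T, p j * Real.log (1 / p j)) / Real.log 2 := by
    rw [mapEntropy_eq_sum_image, sum_div]
    have e : ∀ j, ((fiber S f j).card : ℝ) / S.card * Real.logb 2 ((S.card : ℝ) / (fiber S f j).card)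
        = p j * Real.log (1 / p j) / Real.log 2 := by
      intro j
      simp only [hp, Real.logb, one_div, inv_div]
      ring
    simp_rw [e]
    refine sum_subset himg fun j _ hj => ?_
    have : fiber S f j = ∅ := by
      refine eq_empty_of_forall_notMem fun w hw => hj ?_
      rw [mem_fiber] at hw
      exact mem_image.2 ⟨w, hw.1, hw.2⟩
    simp [hp, this]
  -- `p log(1/p) = p log((1/N)/p) + p log N`, then `mul_log_div_eq_klFun`
  have hterm : ∀ j, p j * Real.log (1 / p j) =
      (1 / N - p j - 1 / N * klFun (p j / (1 / N))) + p j * Real.log N := by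
    intro j
    rw [← mul_log_div_eq_klFun (hp0 j) (by positivity)]
    rcases (hp0 j).eq_or_lt with h0 | hpos
    · rw [← h0]
      simp
    · rw [← mul_add, ← Real.log_mul (by positivity) hTpos.ne']
      congr 1
      field_simp
  have hklsum : ∑ j ∈ T, p j * Real.log (1 / p j) =
      Real.log N - (∑ j ∈ T, klFun (N * p j)) / N := by
    simp_rw [hterm]
    rw [sum_add_distrib, sum_sub_distrib, sum_sub_distrib, ← sum_mul, hsum, ← mul_sum, sum_const,
      nsmul_eq_mul, ← hN]
    have e : ∀ j, p j / (1 / N) = N * p j := fun j => by field_simp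
    simp_rw [e]
    field_simp
    ring
  -- keep the `j₀` term only
  have hdrop : klFun (N * p j₀) ≤ ∑ j ∈ T, klFun (N * p j) :=
    single_le_sum (f := fun j => klFun (N * p j)) (fun j _ => klFun_nonneg (by positivity)) hj₀
  rw [hH, hklsum, Real.logb, sub_div]
  have e1 : klFun (N * p j₀) / (N * Real.log 2) = klFun (N * p j₀) / N / Real.log 2 := by
    rw [div_div]
  rw [e1]
  gcongr

/-! ### The gap constant `min (klFun (1+ε)) (klFun (1+ε)⁻¹)` -/

/-- Below `(1+ε)⁻¹` the convex function `klFun` (minimum `0` at `1`) is at least `klFun (1+ε)⁻¹`.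
[folklore] -/
theorem klFun_inv_le_of_le {ε x : ℝ} (hε : 0 < ε) (hx0 : 0 ≤ x) (hx : x ≤ (1 + ε)⁻¹) :
    klFun (1 + ε)⁻¹ ≤ klFun x := by
  have h1 : (1 + ε)⁻¹ ≤ 1 := inv_le_one_of_one_le₀ (by linarith)
  have h := convexOn_klFun.le_max_of_mem_Icc (x := x) (y := 1) (z := (1 + ε)⁻¹)
    (Set.mem_Ici.2 hx0) (Set.mem_Ici.2 zero_le_one) ⟨hx, h1⟩
  rwa [klFun_one, max_eq_left (klFun_nonneg hx0)] at h

/-- Above `1+ε` the convex function `klFun` (minimum `0` at `1`) is at least `klFun (1+ε)`.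
[folklore] -/
theorem klFun_le_of_le {ε x : ℝ} (hε : 0 < ε) (hx : 1 + ε ≤ x) : klFun (1 + ε) ≤ klFun x := by
  have hx0 : 0 ≤ x := by linarith
  have h := convexOn_klFun.le_max_of_mem_Icc (x := 1) (y := x) (z := 1 + ε)
    (Set.mem_Ici.2 zero_le_one) (Set.mem_Ici.2 hx0) ⟨by linarith, hx⟩
  rwa [klFun_one, max_eq_right (klFun_nonneg hx0)] at h

/-- The gap constant is positive: `klFun` vanishes only at `1`. [folklore] -/
theorem klFun_gap_pos {ε : ℝ} (hε : 0 < ε) : 0 < min (klFun (1 + ε)) (klFun (1 + ε)⁻¹) := by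
  refine lt_min ?_ ?_
  · refine lt_of_le_of_ne (klFun_nonneg (by linarith)) (Ne.symm ?_)
    rw [Ne, klFun_eq_zero_iff (by linarith)]
    linarith
  · have h0 : (0 : ℝ) ≤ (1 + ε)⁻¹ := by positivity
    refine lt_of_le_of_ne (klFun_nonneg h0) (Ne.symm ?_)
    rw [Ne, klFun_eq_zero_iff h0]
    have : (1 + ε)⁻¹ < 1 := inv_lt_one_of_one_lt₀ (by linarith)
    exact this.ne

/-! ### `m`-fold sub-additivity -/

/-- **Sub-additivity over finitely many coordinates**: the entropy of the tuple `(fᵢ(U_S))ᵢ` is at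
most the sum of the entropies of its coordinates, `H((fᵢ)ᵢ) ≤ ∑ᵢ H(fᵢ)` (Cover–Thomas (2.96),
iterated; induction on the set of coordinates with `mapEntropy_prod_le`). [folklore] -/
theorem mapEntropy_pi_le {κ : Type*} [Fintype κ] [DecidableEq κ] {X : κ → Type*}
    [∀ i, DecidableEq (X i)] (S : Finset ι) (f : ∀ i, ι → X i) :
    mapEntropy S (fun v => fun i => f i v) ≤ ∑ i, mapEntropy S (f i) := by
  classical
  suffices h : ∀ s : Finset κ,
      mapEntropy S (fun v => fun i : s => f i v) ≤ ∑ i ∈ s, mapEntropy S (f i) by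
    refine le_trans (le_of_eq ?_) (h univ)
    refine mapEntropy_eq_of_ker_eq fun a _ b _ => ?_
    simp only [funext_iff, Subtype.forall, mem_univ, forall_true_left]
  intro s
  induction s using Finset.induction_on with
  | empty =>
    rw [sum_empty]
    have e : mapEntropy S (fun v => fun i : ((∅ : Finset κ) : Finset κ) => f i v) =
        mapEntropy S (fun _ => (0 : ℕ)) :=
      mapEntropy_eq_of_ker_eq fun a _ b _ =>
        ⟨fun _ => rfl, fun _ => funext fun i => (notMem_empty i.1 i.2).elim⟩
    rw [e, mapEntropy_const]
  | insert a s ha ih =>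
    calc mapEntropy S (fun v => fun i : (insert a s : Finset κ) => f i v)
        = mapEntropy S (fun v => (f a v, fun i : s => f i v)) := by
          refine mapEntropy_eq_of_ker_eq fun x _ y _ => ?_
          simp only [funext_iff, Prod.mk.injEq, Subtype.forall, mem_insert, forall_eq_or_imp]
      _ ≤ mapEntropy S (f a) + mapEntropy S (fun v => fun i : s => f i v) :=
          mapEntropy_prod_le S _ _
      _ ≤ mapEntropy S (f a) + ∑ i ∈ s, mapEntropy S (f i) := by linarith [ih]
      _ = ∑ i ∈ insert a s, mapEntropy S (f i) := by rw [sum_insert ha]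

/-! ### Lemma 10 -/

/-- **Large subsets of a product have few biased coordinates** (Rothvoss 2017, Lemma 10; Razborov).
For all `ε > 0` and `q ∈ ℕ` there is `δ > 0` such that: for finite types `X i` (`i : κ`,
`m = |κ|`) with `1 ≤ |X i| ≤ q` and every `Y ⊆ Π i, X i` with `|Y| ≥ 2^{-δ m} ∏ᵢ |X i|`, there is an
exceptional set `B` of at most `ε m` indices outside of which every index `i` is `ε`-unbiased:
`|Y| / ((1+ε) |X i|) ≤ #{y ∈ Y : y i = j} ≤ (1+ε) |Y| / |X i|` for all `j : X i`.
(Explicitly `δ = ε · min (klFun (1+ε)) (klFun (1+ε)⁻¹) / ((q+1) ln 2)`.)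
[cite: Rothvoss2017, Lem. 10] -/
theorem few_biased_coordinates {ε : ℝ} (hε : 0 < ε) (q : ℕ) :
    ∃ δ : ℝ, 0 < δ ∧ ∀ {κ : Type u} [Fintype κ] [DecidableEq κ] {X : κ → Type v}
      [∀ i, Fintype (X i)] [∀ i, DecidableEq (X i)],
      (∀ i, Fintype.card (X i) ≤ q) → (∀ i, 0 < Fintype.card (X i)) →
      ∀ Y : Finset ((i : κ) → X i),
        (2 : ℝ) ^ (-(δ * Fintype.card κ)) * ∏ i, (Fintype.card (X i) : ℝ) ≤ Y.card →
        ∃ B : Finset κ, (B.card : ℝ) ≤ ε * Fintype.card κ ∧ ∀ i ∉ B, ∀ j : X i,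
          (Y.card : ℝ) / ((1 + ε) * Fintype.card (X i)) ≤ (Y.filter fun y => y i = j).card ∧
          ((Y.filter fun y => y i = j).card : ℝ) ≤ (1 + ε) * Y.card / Fintype.card (X i) := by
  set c : ℝ := min (klFun (1 + ε)) (klFun (1 + ε)⁻¹) with hc
  have hcpos : 0 < c := klFun_gap_pos hε
  have hlog2 : (0 : ℝ) < Real.log 2 := Real.log_pos one_lt_two
  set γ : ℝ := c / ((q + 1) * Real.log 2) with hγ
  have hγpos : 0 < γ := by positivity
  refine ⟨ε * γ, by positivity, ?_⟩
  intro κ _ _ X _ _ hXq hX0 Y hY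
  classical
  set m : ℕ := Fintype.card κ with hm
  have hprodpos : (0 : ℝ) < ∏ i, (Fintype.card (X i) : ℝ) :=
    prod_pos fun i _ => by exact_mod_cast hX0 i
  have hYpos : (0 : ℝ) < Y.card := lt_of_lt_of_le (by positivity) hY
  have hYne : Y.Nonempty := card_pos.1 (by exact_mod_cast hYpos)
  -- the counts
  set cnt : ∀ i, X i → ℝ := fun i j => ((Y.filter fun y => y i = j).card : ℝ) with hcnt
  set bad : κ → Prop := fun i => ∃ j : X i,
    ¬ ((Y.card : ℝ) / ((1 + ε) * Fintype.card (X i)) ≤ cnt i j ∧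
        cnt i j ≤ (1 + ε) * Y.card / Fintype.card (X i)) with hbad
  set B : Finset κ := univ.filter bad with hB
  refine ⟨B, ?_, fun i hi j => ?_⟩
  swap
  · by_contra h
    exact hi (mem_filter.2 ⟨mem_univ _, j, h⟩)
  -- entropy of each coordinate
  have hcoord : ∀ i, mapEntropy Y (fun y => y i) ≤
      Real.logb 2 (Fintype.card (X i)) - (if i ∈ B then γ else 0) := by
    intro i
    have hN : (0 : ℝ) < Fintype.card (X i) := by exact_mod_cast hX0 i
    have hNq : (Fintype.card (X i) : ℝ) < q + 1 := by exact_mod_cast Nat.lt_succ_of_le (hXq i)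
    -- choose the test value `j₀`
    obtain ⟨j₀, hj₀⟩ : ∃ j₀ : X i, i ∈ B → ¬ ((Y.card : ℝ) / ((1 + ε) * Fintype.card (X i)) ≤
        cnt i j₀ ∧ cnt i j₀ ≤ (1 + ε) * Y.card / Fintype.card (X i)) := by
      by_cases hiB : i ∈ B
      · obtain ⟨j, hj⟩ := (mem_filter.1 hiB).2
        exact ⟨j, fun _ => hj⟩
      · have : Nonempty (X i) := Fintype.card_pos_iff.1 (hX0 i)
        exact ⟨Classical.arbitrary _, fun h => (hiB h).elim⟩
    have hH := mapEntropy_le_logb_sub_klFun hYne (fun y => y i) (T := (univ : Finset (X i)))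
      (fun y _ => mem_univ _) (mem_univ j₀)
    rw [card_univ] at hH
    refine hH.trans (sub_le_sub_left ?_ _)
    have hfib : ((fiber Y (fun y => y i) j₀).card : ℝ) = cnt i j₀ := by simp [fiber, hcnt]
    rw [hfib]
    split_ifs with hiB
    · -- biased: `klFun ≥ c`
      set x : ℝ := Fintype.card (X i) * (cnt i j₀ / Y.card) with hx
      have hx0 : 0 ≤ x := by positivity
      have hklc : c ≤ klFun x := by
        have hb := hj₀ hiB
        rcases not_and_or.1 hb with hlow | hup
        · -- count too small: `x ≤ (1+ε)⁻¹`
          have hlt : cnt i j₀ < (Y.card : ℝ) / ((1 + ε) * Fintype.card (X i)) := not_le.1 hlow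
          have hxlt : x * (1 + ε) < 1 := by
            rw [lt_div_iff₀ (by positivity)] at hlt
            have e : x * (1 + ε) = cnt i j₀ * ((1 + ε) * Fintype.card (X i)) / Y.card := by
              rw [hx]
              ring
            rw [e, div_lt_one hYpos]
            exact hlt
          have hxle : x ≤ (1 + ε)⁻¹ :=
            calc x = x * (1 + ε) * (1 + ε)⁻¹ := by field_simp
              _ ≤ 1 * (1 + ε)⁻¹ := mul_le_mul_of_nonneg_right hxlt.le (by positivity)
              _ = (1 + ε)⁻¹ := one_mul _
          exact (min_le_right _ _).trans (klFun_inv_le_of_le hε hx0 hxle)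
        · -- count too large: `1+ε ≤ x`
          have hlt : (1 + ε) * Y.card / Fintype.card (X i) < cnt i j₀ := not_le.1 hup
          have hxge : 1 + ε ≤ x := by
            rw [div_lt_iff₀ hN] at hlt
            rw [hx, mul_div_assoc', le_div_iff₀ hYpos]
            linarith
          exact (min_le_left _ _).trans (klFun_le_of_le hε hxge)
      calc γ = c / ((q + 1) * Real.log 2) := hγ
        _ ≤ c / (Fintype.card (X i) * Real.log 2) := by
            gcongr
        _ ≤ klFun x / (Fintype.card (X i) * Real.log 2) := by
            gcongr
    · exact div_nonneg (klFun_nonneg (by positivity)) (by positivity)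
  -- sub-additivity: `log₂ |Y| ≤ ∑ H(yᵢ)`
  have hsub : Real.logb 2 Y.card ≤ ∑ i, mapEntropy Y (fun y => y i) := by
    rw [← mapEntropy_of_injective Y (f := fun y : (i : κ) → X i => fun i => y i)
      (fun a b h => h)]
    exact mapEntropy_pi_le Y (fun i (y : (i : κ) → X i) => y i)
  have h1 : Real.logb 2 Y.card ≤ ∑ i, Real.logb 2 (Fintype.card (X i)) - B.card * γ := by
    calc Real.logb 2 Y.card
        ≤ ∑ i, (Real.logb 2 (Fintype.card (X i)) - (if i ∈ B then γ else 0)) :=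
          hsub.trans (sum_le_sum fun i _ => hcoord i)
      _ = ∑ i, Real.logb 2 (Fintype.card (X i)) - ∑ i, (if i ∈ B then γ else 0) :=
          sum_sub_distrib _ _
      _ = ∑ i, Real.logb 2 (Fintype.card (X i)) - B.card * γ := by
          rw [sum_ite_mem, univ_inter, sum_const, nsmul_eq_mul]
  -- the size hypothesis in logarithmic form
  have h2 : -(ε * γ * m) + ∑ i, Real.logb 2 (Fintype.card (X i)) ≤ Real.logb 2 Y.card := by
    have h := Real.logb_le_logb_of_le one_lt_two (by positivity) hY
    rw [Real.logb_mul (by positivity) hprodpos.ne', Real.logb_rpow two_pos (by norm_num),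
      Real.logb_prod _ _ fun i _ => (ne_of_gt (by exact_mod_cast hX0 i))] at h
    simpa [hm] using h
  have h3 : (B.card : ℝ) * γ ≤ ε * m * γ := by nlinarith
  exact le_of_mul_le_mul_right h3 hγpos

end Literature.InformationTheory.Entropy
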